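import Mathlib.LinearAlgebra.Matrix.MvPolynomial
import Mathlib.LinearAlgebra.Matrix.Permanent
import Mathlib.LinearAlgebra.Matrix.Determinant.Basic
import Mathlib.LinearAlgebra.Matrix.Permutation
import Mathlib.LinearAlgebra.Matrix.Block
import Mathlib.GroupTheory.Perm.Cycle.Type
import Mathlib.GroupTheory.Perm.Finite
import Mathlib.RingTheory.MvPolynomial.Homogeneous
import Literature.Computability.AlgebraicComplexity.StandardFamilies
import Literature.Computability.AlgebraicComplexity.ValiantClasses
import HarnessLib

/-!
# Generalized matrix functions (Schur's `χ`-immanants) as generic polynomials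

Definition request `defn-genMatrixPoly` (route `ImmanantSlice` of `ValiantsHypothesis`), topic
`Literature/Computability/AlgebraicComplexity`.

For a coefficient function `χ : 𝔖ₙ → R` on the symmetric group (in Lean `χ : Equiv.Perm n → R`,
`n` a finite index type, `R` a commutative semiring) the *generalized matrix function* of Schur
(1918) — the `χ`-immanant, or `f`-immanant for `f = χ` in Curticapean's terminology — is

  `d_χ(M) = ∑_{σ ∈ 𝔖ₙ} χ(σ) ∏ᵢ M_{σ(i), i}`        (`genMatrixFun χ M`),

and its generic instance, the polynomial in the `n²` entries `X_{ij}` of the generic matrix,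

  `genMatrixPoly χ = ∑_{σ ∈ 𝔖ₙ} C (χ σ) * ∏ᵢ X_{(σ i, i)} : MvPolynomial (n × n) R`.

Curticapean 2021, §1: "Given any class function `f : Sₙ → ℂ` … the immanant
`imm_f : ℂ^{n×n} → ℂ` is defined by replacing the permutation sign in the determinant expansion
with `f(π)`: `imm_f(X) = ∑_{π ∈ Sₙ} f(π) ∏ᵢ x_{i,π(i)}`"; `det = imm_sgn`, `per = imm_1`, and for
`f = χ_λ` an irreducible character one gets the (character) immanants of Littlewood–Richardson;
Bürgisser 2000 (SIAM J. Comput. 30), §2 uses the same objects. The special cases in the tree are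
the generic permanent `perPoly` (`χ = 1`), determinant `detPoly` (`χ = sgn`) and Hamiltonian
cycle polynomial `hcPoly` (`χ` = indicator of the `n`-cycles) of
`Literature.Computability.AlgebraicComplexity.StandardFamilies` (Bürgisser 2000, (2.1)–(2.3)).

## Contents

* `genMatrixPoly χ`, `genMatrixFun χ M`; unfolding, linearity in `χ`, evaluation
  (`eval_genMatrixPoly`, `aeval_genMatrixPoly`, `aeval_genMatrixPoly_matrix`), base change,
  homogeneity of degree `card n`, `totalDegree ≤ card n`, p-family over `Fin n`;
* special cases `genMatrixPoly_one = perPoly`, `genMatrixPoly_sign = detPoly`,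
  `genMatrixPoly_indicator`, `genMatrixPoly_cycleType_eq_card = hcPoly`;
* the row convention: `genMatrixFun χ Mᵀ = genMatrixFun (χ ∘ ⁻¹) M`,
  `rename Prod.swap (genMatrixPoly χ) = genMatrixPoly (χ ∘ ⁻¹)` (so for class functions the two
  conventions `M_{σ i, i}` / `M_{i, σ i}` agree);
* class functions: `IsClassFunction χ := ∀ g h, IsConj g h → χ g = χ h` (any monoid), closure
  properties, `isClassFunction_perm_iff` (class functions on `Equiv.Perm n` are the functions of
  the cycle type, `Equiv.Perm.isConj_iff_cycleType_eq`), `sign` is a class function;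
* the long-cycle locus `Π_k(n)`: `longCycleLocus n k = {σ | σ has no fixed point and every cycle
  of σ is longer than k}` as a `Finset`, membership via the cycle type, conjugation invariance,
  the `n`-cycles and the two-cycle classes `(a, b)` lie in it;
* the two cheap operators of the route as Valiant projections: for `χ : Equiv.Perm (n ⊕ o) → R`
  and `γ : Equiv.Perm o`, substituting the block matrix `X ⊕ P_γ` (generic matrix on `n`,
  the permutation matrix of `γ` on `o`, zero off-diagonal blocks) into `genMatrixPoly χ` gives
  `genMatrixPoly (τ ↦ χ (τ ⊕ γ))` (`genMatrixFun_fromBlocks_permMatrix`,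
  `genMatrixPoly_sumCongr`, `isProjection_genMatrixPoly_sumCongr`); `γ = 1` is the restriction
  `𝔖_{n+o} → 𝔖ₙ` ("`τ` with extra fixed points", block `X ⊕ 1`), a `j`-cycle `γ` is the
  insertion of a `j`-cycle block; `Fin`-indexed forms via `finSumFinEquiv`
  (`isProjection_genMatrixPoly_finSum`).

## Design choices

* Convention `∏ᵢ X_{(σ i, i)}` (entry `M (σ i) i`), the convention of `Matrix.permanent`,
  `Matrix.det_apply`, `perPoly`, `hcPoly` and of the route file, *not* Curticapean's `x_{i, π(i)}`;
  the two differ by `σ ↦ σ⁻¹` (`genMatrixPoly_rename_swap`) and agree on class functions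
  (`IsClassFunction.map_inv`). With this convention "the permutation matrix of `γ`" whose only
  nonzero generalized diagonal is `γ` is `P_γ = (if i = γ j then 1 else 0)ᵢⱼ = (γ⁻¹).permMatrix R`
  (Mathlib's `Equiv.Perm.permMatrix γ` has entries `if γ i = j`); statements use
  `(γ⁻¹).permMatrix` and `permMatrix_inv_apply` unfolds it.
* `genMatrixPoly χ` is *literally* `∑ σ, C (χ σ) * ∏ i, X (σ i, i)`, so that the sums inlined in
  the route `ImmanantSlice` are `genMatrixPoly (χ n)` by `rfl`; likewise `IsClassFunction (χ n)`
  unfolds by `rfl` to the inlined `∀ σ τ, IsConj σ τ → χ n σ = χ n τ`, and membership in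
  `longCycleLocus (Fin n) k` to `(∀ i, σ i ≠ i) ∧ ∀ m ∈ σ.cycleType, k < m` (`mem_longCycleLocus`).
* Coefficients: any `[CommSemiring R]` (`[CommRing R]` for the determinant), index type any
  `[Fintype n] [DecidableEq n]`, as in `StandardFamilies`.
* Not provided: immanants of irreducible characters `χ_λ` (Mathlib has no character theory of
  `𝔖ₙ`; searched `Specht`, `immanant`, `ClassFunction` — no hits); they are `genMatrixPoly χ_λ`
  once `χ_λ` is available.
* Mathlib reused: `Matrix.mvPolynomialX`, `Matrix.permanent`, `Matrix.det_apply`,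
  `Equiv.Perm.permMatrix`, `Matrix.fromBlocks`, `Equiv.Perm.sumCongr`,
  `Equiv.Perm.mem_sumCongrHom_range_of_perm_mapsTo_inl` (the block argument of
  `Matrix.det_fromBlocks_zero₂₁`), `Equiv.Perm.cycleType`, `Equiv.Perm.isConj_iff_cycleType_eq`,
  `Equiv.Perm.sum_cycleType`, `MvPolynomial.IsHomogeneous`.

## References

* I. Schur, *Über endliche Gruppen und Hermitesche Formen*, Math. Z. 1 (1918), 184–207
  (generalized matrix functions `d_χ`).
* R. Curticapean, *A full complexity dichotomy for immanant families*, STOC 2021, §1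
  (doi:10.1145/3406325.3451124, arXiv:2102.04340; definition of `imm_f` for a class function `f`,
  `det = imm_sgn`, `per = imm_1`).
* P. Bürgisser, *The computational complexity of immanants*, SIAM J. Comput. 30 (2000),
  1023–1040, §2 (doi:10.1137/s0097539798367880).
* P. Bürgisser, *Completeness and Reduction in Algebraic Complexity Theory*, Springer 2000,
  §2.1, (2.1)–(2.3) (`DET`, `PER`, `HC`), Def. 2.3 (p-families), Def. 2.6 (projections).
-/

noncomputable section

open MvPolynomial Finset

namespace Literature.Computability.AlgebraicComplexity

universe u

/-! ### The generalized matrix function and its generic polynomial -/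

section Defs

variable {n : Type*} [Fintype n] [DecidableEq n] {R : Type u} [CommSemiring R]

/-- Schur's *generalized matrix function* (the `χ`-immanant) of a square matrix `M` with
coefficient function `χ : 𝔖ₙ → R`: `d_χ(M) = ∑_{σ ∈ 𝔖ₙ} χ(σ) ∏ᵢ M (σ i) i`
(convention of `Matrix.permanent` / `Matrix.det_apply`; Curticapean 2021, §1 writes
`∏ᵢ M_{i, π(i)}`, which is `d_χ(Mᵀ) = d_{χ ∘ ⁻¹}(M)`, see `genMatrixFun_transpose`).
`χ = 1` gives the permanent, `χ = sgn` the determinant. [cite: Curticapean2021, §1] -/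
def genMatrixFun (χ : Equiv.Perm n → R) (M : Matrix n n R) : R :=
  ∑ σ : Equiv.Perm n, χ σ * ∏ i : n, M (σ i) i

/-- The *generic generalized matrix function* (generic `χ`-immanant) with coefficient function
`χ : 𝔖ₙ → R`: the polynomial `∑_{σ ∈ 𝔖ₙ} C (χ σ) · ∏ᵢ X_{(σ i, i)}` in the `n²` entries of the
generic `n × n` matrix (Schur 1918; Curticapean 2021, §1, `imm_f`; Bürgisser 2000, §2).
Special cases: `genMatrixPoly 1 = perPoly n R` (`genMatrixPoly_one`), `genMatrixPoly sgn =
detPoly n R` (`genMatrixPoly_sign`), the indicator of the `n`-cycles gives `hcPoly n R`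
(`genMatrixPoly_cycleType_eq_card`). The definition is literally the sum inlined in route
`ImmanantSlice`, so `genMatrixPoly (χ n)` matches it by `rfl`. [cite: Curticapean2021, §1] -/
def genMatrixPoly (χ : Equiv.Perm n → R) : MvPolynomial (n × n) R :=
  ∑ σ : Equiv.Perm n, C (χ σ) * ∏ i : n, X (σ i, i)

/-- Unfolding lemma for `genMatrixPoly`. [folklore] -/
theorem genMatrixPoly_def (χ : Equiv.Perm n → R) :
    genMatrixPoly χ = ∑ σ : Equiv.Perm n, C (χ σ) * ∏ i : n, X (σ i, i) :=
  rfl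

/-- Unfolding lemma for `genMatrixFun`. [folklore] -/
theorem genMatrixFun_def (χ : Equiv.Perm n → R) (M : Matrix n n R) :
    genMatrixFun χ M = ∑ σ : Equiv.Perm n, χ σ * ∏ i : n, M (σ i) i :=
  rfl

/-- `genMatrixPoly χ` is `d_{C ∘ χ}` of the generic matrix `(X_{ij})`. [folklore] -/
theorem genMatrixPoly_eq_genMatrixFun (χ : Equiv.Perm n → R) :
    genMatrixPoly χ = genMatrixFun (fun σ => C (χ σ)) (Matrix.mvPolynomialX n n R) :=
  rfl

/-! #### Linearity in the coefficient function -/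

/-- `χ ↦ genMatrixPoly χ` is linear: zero. [folklore] -/
@[simp]
theorem genMatrixPoly_zero : genMatrixPoly (0 : Equiv.Perm n → R) = 0 := by
  simp [genMatrixPoly]

/-- `χ ↦ genMatrixPoly χ` is linear: additivity (sums of immanants are immanants).
[folklore] -/
theorem genMatrixPoly_add (χ ψ : Equiv.Perm n → R) :
    genMatrixPoly (χ + ψ) = genMatrixPoly χ + genMatrixPoly ψ := by
  simp [genMatrixPoly, add_mul, sum_add_distrib]

/-- `χ ↦ genMatrixPoly χ` is linear: homogeneity. [folklore] -/
theorem genMatrixPoly_smul (c : R) (χ : Equiv.Perm n → R) :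
    genMatrixPoly (c • χ) = c • genMatrixPoly χ := by
  simp [genMatrixPoly, Finset.smul_sum, smul_eq_C_mul, mul_assoc]

/-- `χ ↦ genMatrixPoly χ` is linear: finite sums (e.g. `f`-immanants as linear combinations of
character immanants, Curticapean 2021, §1). [cite: Curticapean2021, §1] -/
theorem genMatrixPoly_sum {ι : Type*} (s : Finset ι) (χ : ι → Equiv.Perm n → R) :
    genMatrixPoly (∑ j ∈ s, χ j) = ∑ j ∈ s, genMatrixPoly (χ j) := by
  simp only [genMatrixPoly, Finset.sum_apply, map_sum, sum_mul]
  exact Finset.sum_comm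

/-- `χ ↦ d_χ(M)` is linear: zero. [folklore] -/
@[simp]
theorem genMatrixFun_zero (M : Matrix n n R) : genMatrixFun (0 : Equiv.Perm n → R) M = 0 := by
  simp [genMatrixFun]

/-- `χ ↦ d_χ(M)` is linear: additivity. [folklore] -/
theorem genMatrixFun_add (χ ψ : Equiv.Perm n → R) (M : Matrix n n R) :
    genMatrixFun (χ + ψ) M = genMatrixFun χ M + genMatrixFun ψ M := by
  simp [genMatrixFun, add_mul, sum_add_distrib]

/-- `χ ↦ d_χ(M)` is linear: homogeneity. [folklore] -/
theorem genMatrixFun_smul (c : R) (χ : Equiv.Perm n → R) (M : Matrix n n R) :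
    genMatrixFun (c • χ) M = c * genMatrixFun χ M := by
  simp [genMatrixFun, Finset.mul_sum, mul_assoc]

/-! #### Evaluation and base change -/

/-- Evaluating the generic `χ`-immanant at a point `s` gives `∑_σ χ(σ) ∏ᵢ s (σ i, i)`, i.e. the
generalized matrix function `d_χ` of the matrix `(s (i, j))ᵢⱼ` (Curticapean 2021, §1).
[cite: Curticapean2021, §1] -/
theorem eval_genMatrixPoly (χ : Equiv.Perm n → R) (s : n × n → R) :
    eval s (genMatrixPoly χ) = ∑ σ : Equiv.Perm n, χ σ * ∏ i : n, s (σ i, i) := by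
  simp [genMatrixPoly, map_sum, map_prod]

/-- `eval_genMatrixPoly` in matrix form: `(genMatrixPoly χ)(s) = d_χ ((s (i, j))ᵢⱼ)`.
[cite: Curticapean2021, §1] -/
theorem eval_genMatrixPoly_eq_genMatrixFun (χ : Equiv.Perm n → R) (s : n × n → R) :
    eval s (genMatrixPoly χ) = genMatrixFun χ (Matrix.of fun i j : n => s (i, j)) := by
  simp [eval_genMatrixPoly, genMatrixFun]

/-- Evaluation into an `R`-algebra: `aeval s (genMatrixPoly χ) = ∑_σ χ(σ) • ∏ᵢ s (σ i, i)`.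
[cite: Curticapean2021, §1] -/
theorem aeval_genMatrixPoly {A : Type*} [CommSemiring A] [Algebra R A] (χ : Equiv.Perm n → R)
    (s : n × n → A) :
    aeval s (genMatrixPoly χ) = ∑ σ : Equiv.Perm n, χ σ • ∏ i : n, s (σ i, i) := by
  simp [genMatrixPoly, map_sum, map_prod, Algebra.smul_def]

/-- Substituting the entries of a matrix `M` over an `R`-algebra `A` for the variables `X_{ij}`
of `genMatrixPoly χ` gives `d_{χ'}(M)` with `χ' = algebraMap R A ∘ χ`.
[cite: Curticapean2021, §1] -/
theorem aeval_genMatrixPoly_matrix {A : Type*} [CommSemiring A] [Algebra R A]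
    (χ : Equiv.Perm n → R) (M : Matrix n n A) :
    aeval (fun ij : n × n => M ij.1 ij.2) (genMatrixPoly χ) =
      genMatrixFun (fun σ => algebraMap R A (χ σ)) M := by
  simp [genMatrixPoly, genMatrixFun, map_sum, map_prod]

/-- Base change: `genMatrixPoly` commutes with ring homomorphisms of the coefficients. [folklore] -/
theorem map_genMatrixPoly {R' : Type*} [CommSemiring R'] (f : R →+* R') (χ : Equiv.Perm n → R) :
    map f (genMatrixPoly χ) = genMatrixPoly fun σ => f (χ σ) := by
  simp [genMatrixPoly, map_sum, map_prod]

/-- Ring homomorphisms commute with generalized matrix functions (entrywise). [folklore] -/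
theorem map_genMatrixFun {R' : Type*} [CommSemiring R'] (f : R →+* R') (χ : Equiv.Perm n → R)
    (M : Matrix n n R) :
    f (genMatrixFun χ M) = genMatrixFun (fun σ => f (χ σ)) (M.map f) := by
  simp [genMatrixFun, map_sum, map_prod]

/-! #### Special cases: permanent, determinant, indicator sums, Hamiltonian cycles -/

/-- `χ = 1`: the generic `1`-immanant is the generic permanent `PER_n`
(Curticapean 2021, §1, `per = imm_1`; Bürgisser 2000, (2.2)). [cite: Curticapean2021, §1] -/
theorem genMatrixPoly_one : genMatrixPoly (1 : Equiv.Perm n → R) = perPoly n R := by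
  simp [genMatrixPoly, perPoly, Matrix.permanent, Matrix.mvPolynomialX]

/-- `χ ≡ 1` (unbundled spelling of `genMatrixPoly_one`). [cite: Curticapean2021, §1] -/
theorem genMatrixPoly_const_one : genMatrixPoly (fun _ : Equiv.Perm n => (1 : R)) = perPoly n R :=
  genMatrixPoly_one

/-- `d_1(M) = per M`. [cite: Curticapean2021, §1] -/
theorem genMatrixFun_one (M : Matrix n n R) :
    genMatrixFun (1 : Equiv.Perm n → R) M = M.permanent := by
  simp [genMatrixFun, Matrix.permanent]

/-- `χ = sgn`: the generic `sgn`-immanant is the generic determinant `DET_n`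
(Curticapean 2021, §1, `det = imm_sgn`; Bürgisser 2000, (2.1)). [cite: Curticapean2021, §1] -/
theorem genMatrixPoly_sign {R : Type u} [CommRing R] :
    genMatrixPoly (fun σ : Equiv.Perm n => ((Equiv.Perm.sign σ : ℤ) : R)) = detPoly n R := by
  rw [detPoly, Matrix.det_apply, genMatrixPoly]
  refine sum_congr rfl fun σ _ => ?_
  rw [Units.smul_def, zsmul_eq_mul, map_intCast]
  rfl

/-- `d_sgn(M) = det M`. [cite: Curticapean2021, §1] -/
theorem genMatrixFun_sign {R : Type u} [CommRing R] (M : Matrix n n R) :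
    genMatrixFun (fun σ : Equiv.Perm n => ((Equiv.Perm.sign σ : ℤ) : R)) M = M.det := by
  rw [Matrix.det_apply, genMatrixFun]
  refine sum_congr rfl fun σ _ => ?_
  rw [Units.smul_def, zsmul_eq_mul]

/-- An indicator coefficient function gives the plain sum of the monomials `∏ᵢ X_{(σ i, i)}` over
the selected permutations (e.g. cycle-format polynomials). [folklore] -/
theorem genMatrixPoly_indicator (p : Equiv.Perm n → Prop) [DecidablePred p] :
    genMatrixPoly (fun σ : Equiv.Perm n => if p σ then (1 : R) else 0) =
      ∑ σ ∈ univ.filter p, ∏ i : n, X (σ i, i) := by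
  rw [genMatrixPoly, sum_filter]
  refine sum_congr rfl fun σ _ => ?_
  split_ifs <;> simp

/-- The indicator of the `n`-cycles (cycle type `{card n}`) gives the generic Hamiltonian cycle
polynomial `HC_n` (Bürgisser 2000, (2.3); Curticapean 2021, §1: "the number of Hamiltonian
cycles … the immanant associated with the indicator of the cyclic permutations").
[cite: Burgisser2000, (2.3)] -/
theorem genMatrixPoly_cycleType_eq_card :
    genMatrixPoly (fun σ : Equiv.Perm n => if σ.cycleType = {Fintype.card n} then (1 : R) else 0) =
      hcPoly n R := by
  rw [genMatrixPoly_indicator]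
  rfl

/-! #### Degree -/

/-- `genMatrixPoly χ` is homogeneous of degree `card n` (each monomial `∏ᵢ X_{(σ i, i)}` has
degree `n`; Bürgisser 2000, §2.1). [cite: Burgisser2000, §2.1] -/
theorem genMatrixPoly_isHomogeneous (χ : Equiv.Perm n → R) :
    (genMatrixPoly χ).IsHomogeneous (Fintype.card n) := by
  refine IsHomogeneous.sum _ _ _ fun σ _ => ?_
  have := IsHomogeneous.prod (φ := fun i : n => (X (σ i, i) : MvPolynomial (n × n) R)) univ
    (fun _ => 1) fun i _ => isHomogeneous_X R (σ i, i)
  simp only [sum_const, smul_eq_mul, mul_one, card_univ] at this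
  simpa only [zero_add] using (isHomogeneous_C _ _).mul this

/-- `deg genMatrixPoly χ ≤ card n`. [cite: Burgisser2000, §2.1] -/
theorem totalDegree_genMatrixPoly_le (χ : Equiv.Perm n → R) :
    (genMatrixPoly χ).totalDegree ≤ Fintype.card n :=
  (genMatrixPoly_isHomogeneous χ).totalDegree_le

end Defs

/-- Every family `(d_{χ_n})_n` of generic immanants over `Fin n` is a p-family: `n²` variables and
degree `≤ n` (Bürgisser 2000, Def. 2.3; as for `PER`, `DET`, `HC`). In particular
`IsVPFamily (fun n => genMatrixPoly (χ n)) ↔ IsPComputable (fun n => genMatrixPoly (χ n))`.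
[cite: Burgisser2000, Def. 2.3] -/
theorem isPFamily_genMatrixPoly {R : Type u} [CommSemiring R] (χ : ∀ m, Equiv.Perm (Fin m) → R) :
    IsPFamily fun m => genMatrixPoly (χ m) := by
  refine ⟨(IsPBounded.iff_exists_le_mul_succ_pow _).2 ⟨1, 2, fun m => ?_⟩,
    (IsPBounded.iff_exists_le_mul_succ_pow _).2 ⟨1, 1, fun m => ?_⟩⟩
  · have h : 1 * (m + 1) ^ 2 = m * m + 2 * m + 1 := by ring
    simp only [Fintype.card_prod, Fintype.card_fin]
    omega
  · dsimp only
    calc (genMatrixPoly (χ m)).totalDegree ≤ Fintype.card (Fin m) :=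
          totalDegree_genMatrixPoly_le _
      _ ≤ 1 * (m + 1) ^ 1 := by simp

/-- `VP`-membership of an immanant family is just p-computability (the p-family condition is
automatic, `isPFamily_genMatrixPoly`). [cite: Burgisser2000, Def. 2.4] -/
theorem isVPFamily_genMatrixPoly_iff {R : Type u} [CommSemiring R]
    (χ : ∀ m, Equiv.Perm (Fin m) → R) :
    IsVPFamily (fun m => genMatrixPoly (χ m)) ↔ IsPComputable fun m => genMatrixPoly (χ m) :=
  ⟨fun h => h.2, fun h => ⟨isPFamily_genMatrixPoly χ, h⟩⟩

/-! ### The row convention: transpose / inverse -/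

section Transpose

variable {n : Type*} [Fintype n] [DecidableEq n] {R : Type u} [CommSemiring R]

/-- Row versus column convention: `d_χ(Mᵀ) = ∑_σ χ(σ) ∏ᵢ M_{i, σ i} = d_{χ ∘ ⁻¹}(M)`; the left
hand side is Curticapean's `imm_χ(M)` (Curticapean 2021, §1). [cite: Curticapean2021, §1] -/
theorem genMatrixFun_transpose (χ : Equiv.Perm n → R) (M : Matrix n n R) :
    genMatrixFun χ M.transpose = genMatrixFun (fun σ => χ σ⁻¹) M := by
  unfold genMatrixFun
  refine Fintype.sum_equiv (Equiv.inv (Equiv.Perm n)) _ _ fun σ => ?_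
  simp only [Equiv.inv_apply, inv_inv, Matrix.transpose_apply]
  congr 1
  rw [← Equiv.prod_comp σ⁻¹ (fun i => M i (σ i))]
  simp

/-- Row versus column convention for the generic polynomial: swapping the two indices of every
variable turns `genMatrixPoly χ` into `genMatrixPoly (χ ∘ ⁻¹)`. [cite: Curticapean2021, §1] -/
theorem genMatrixPoly_rename_swap (χ : Equiv.Perm n → R) :
    rename (Prod.swap : n × n → n × n) (genMatrixPoly χ) = genMatrixPoly fun σ => χ σ⁻¹ := by
  unfold genMatrixPoly
  rw [map_sum]
  refine Fintype.sum_equiv (Equiv.inv (Equiv.Perm n)) _ _ fun σ => ?_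
  simp only [Equiv.inv_apply, inv_inv, map_mul, rename_C, map_prod, rename_X, Prod.swap_prod_mk]
  congr 1
  rw [← Equiv.prod_comp σ⁻¹ (fun i => (X (i, σ i) : MvPolynomial (n × n) R))]
  simp

end Transpose

/-! ### Class functions -/

section ClassFunction

variable {G : Type*} [Monoid G] {β : Type*}

/-- A *class function* on a monoid `G` with values in `β`: a function constant on conjugacy
classes, `IsConj g h → χ g = χ h`. On `𝔖ₙ` these are exactly the functions of the cycle type
(`isClassFunction_perm_iff`; Curticapean 2021, §1: "a function of permutations that depends
only on the (multiset of) cycle lengths"). This is the shape of the hypothesis inlined in route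
`ImmanantSlice` (any codomain: `ℂ`, `NNReal`, …); for a group `G` it is equivalent to the
conjugation form `∀ s t, χ (t * s * t⁻¹) = χ s` (`isClassFunction_iff_forall_conj`), which for
`G : Type`, `β = ℂ` is `Literature.RepresentationTheory.FiniteGroups.IsClassFun` verbatim.
[cite: Curticapean2021, §1] -/
def IsClassFunction (χ : G → β) : Prop :=
  ∀ g h : G, IsConj g h → χ g = χ h

/-- Unfolding lemma for `IsClassFunction`. [folklore] -/
theorem isClassFunction_iff (χ : G → β) :
    IsClassFunction χ ↔ ∀ g h : G, IsConj g h → χ g = χ h :=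
  Iff.rfl

/-- On a group, `IsClassFunction χ` is invariance under conjugation, `χ (t * s * t⁻¹) = χ s`
(the defining formula of `Literature.RepresentationTheory.FiniteGroups.IsClassFun`; Serre,
*Linear Representations*, §2.5). [folklore] -/
theorem isClassFunction_iff_forall_conj {G : Type*} [Group G] (χ : G → β) :
    IsClassFunction χ ↔ ∀ s t : G, χ (t * s * t⁻¹) = χ s := by
  refine ⟨fun h s t => (h s _ (isConj_iff.2 ⟨t, rfl⟩)).symm, fun h g g' hgg' => ?_⟩
  obtain ⟨c, rfl⟩ := isConj_iff.1 hgg'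
  exact (h g c).symm

namespace IsClassFunction

/-- Constant functions are class functions. [folklore] -/
theorem const (b : β) : IsClassFunction fun _ : G => b := fun _ _ _ => rfl

/-- Post-composition preserves class functions. [folklore] -/
theorem comp {χ : G → β} (hχ : IsClassFunction χ) {β' : Type*} (f : β → β') :
    IsClassFunction fun g => f (χ g) := fun g h hgh => congrArg f (hχ g h hgh)

/-- Class functions are closed under pointwise addition. [folklore] -/
theorem add [Add β] {χ ψ : G → β} (hχ : IsClassFunction χ) (hψ : IsClassFunction ψ) :
    IsClassFunction (χ + ψ) := fun g h hgh => by
  simp only [Pi.add_apply, hχ g h hgh, hψ g h hgh]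

/-- Class functions are closed under pointwise multiplication. [folklore] -/
theorem mul [Mul β] {χ ψ : G → β} (hχ : IsClassFunction χ) (hψ : IsClassFunction ψ) :
    IsClassFunction (χ * ψ) := fun g h hgh => by
  simp only [Pi.mul_apply, hχ g h hgh, hψ g h hgh]

/-- Class functions are closed under scalar multiplication. [folklore] -/
theorem smul {α : Type*} [SMul α β] (a : α) {χ : G → β} (hχ : IsClassFunction χ) :
    IsClassFunction (a • χ) := fun g h hgh => by
  simp only [Pi.smul_apply, hχ g h hgh]

/-- Class functions are closed under negation. [folklore] -/
theorem neg [Neg β] {χ : G → β} (hχ : IsClassFunction χ) : IsClassFunction (-χ) :=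
  fun g h hgh => by simp only [Pi.neg_apply, hχ g h hgh]

/-- Class functions are closed under finite sums. [folklore] -/
theorem sum {ι : Type*} [AddCommMonoid β] (s : Finset ι) {χ : ι → G → β}
    (hχ : ∀ j ∈ s, IsClassFunction (χ j)) : IsClassFunction (∑ j ∈ s, χ j) := fun g h hgh => by
  simp only [Finset.sum_apply]
  exact Finset.sum_congr rfl fun j hj => hχ j hj g h hgh

end IsClassFunction

/-- Gluing two class functions along a conjugation-invariant predicate gives a class function
(e.g. `sgn · [σ fixed-point-free with all cycles even]`). [folklore] -/
theorem isClassFunction_ite {p : G → Prop} [DecidablePred p]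
    (hp : ∀ g h : G, IsConj g h → (p g ↔ p h)) {χ ψ : G → β} (hχ : IsClassFunction χ)
    (hψ : IsClassFunction ψ) : IsClassFunction fun g => if p g then χ g else ψ g := by
  intro g h hgh
  dsimp only
  by_cases hg : p g
  · rw [if_pos hg, if_pos ((hp g h hgh).mp hg), hχ g h hgh]
  · rw [if_neg hg, if_neg (mt (hp g h hgh).mpr hg), hψ g h hgh]

/-- A monoid homomorphism to a commutative monoid is a class function (e.g. `Equiv.Perm.sign`).
[folklore] -/
theorem isClassFunction_monoidHom {M : Type*} [CommMonoid M] (f : G →* M) :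
    IsClassFunction (f : G → M) := fun _ _ hgh => isConj_iff_eq.mp (f.map_isConj hgh)

variable {n : Type*} [Fintype n] [DecidableEq n]

/-- On the symmetric group, class functions are exactly the functions of the cycle type
(`Equiv.Perm.isConj_iff_cycleType_eq`). [cite: Curticapean2021, §1] -/
theorem isClassFunction_perm_iff {χ : Equiv.Perm n → β} :
    IsClassFunction χ ↔ ∀ σ τ : Equiv.Perm n, σ.cycleType = τ.cycleType → χ σ = χ τ := by
  simp only [IsClassFunction, Equiv.Perm.isConj_iff_cycleType_eq]

/-- Any function of the cycle type is a class function on `𝔖ₙ`. [cite: Curticapean2021, §1] -/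
theorem isClassFunction_of_cycleType (g : Multiset ℕ → β) :
    IsClassFunction fun σ : Equiv.Perm n => g σ.cycleType := fun _ _ h =>
  congrArg g (Equiv.Perm.isConj_iff_cycleType_eq.mp h)

/-- A class function on `𝔖ₙ` factors through the cycle type. [cite: Curticapean2021, §1] -/
theorem IsClassFunction.exists_eq_comp_cycleType {χ : Equiv.Perm n → β} (hχ : IsClassFunction χ) :
    ∃ g : Multiset ℕ → β, χ = fun σ => g σ.cycleType := by
  classical
  refine ⟨fun m => if h : ∃ σ : Equiv.Perm n, σ.cycleType = m then χ h.choose else χ 1, ?_⟩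
  funext σ
  have h : ∃ τ : Equiv.Perm n, τ.cycleType = σ.cycleType := ⟨σ, rfl⟩
  dsimp only
  rw [dif_pos h]
  exact (isClassFunction_perm_iff.mp hχ) _ _ h.choose_spec.symm

/-- A class function on `𝔖ₙ` is invariant under inversion (`σ⁻¹` has the cycle type of `σ`);
this is why the two conventions `M_{σ i, i}` / `M_{i, σ i}` agree for immanants of class
functions. [cite: Curticapean2021, §1] -/
theorem IsClassFunction.map_inv {χ : Equiv.Perm n → β} (hχ : IsClassFunction χ)
    (σ : Equiv.Perm n) : χ σ⁻¹ = χ σ :=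
  hχ _ _ (Equiv.Perm.isConj_iff_cycleType_eq.mpr (Equiv.Perm.cycleType_inv σ))

/-- The sign character, cast into any commutative ring, is a class function. [folklore] -/
theorem isClassFunction_sign {R : Type u} [CommRing R] :
    IsClassFunction fun σ : Equiv.Perm n => ((Equiv.Perm.sign σ : ℤ) : R) :=
  (isClassFunction_monoidHom Equiv.Perm.sign).comp fun u : ℤˣ => ((u : ℤ) : R)

/-- For a class function the row and column conventions give the same polynomial.
[cite: Curticapean2021, §1] -/
theorem IsClassFunction.genMatrixPoly_rename_swap {R : Type u} [CommSemiring R]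
    {χ : Equiv.Perm n → R} (hχ : IsClassFunction χ) :
    rename (Prod.swap : n × n → n × n) (genMatrixPoly χ) = genMatrixPoly χ := by
  rw [Literature.Computability.AlgebraicComplexity.genMatrixPoly_rename_swap]
  simp only [hχ.map_inv]

/-- For a class function, `d_χ(Mᵀ) = d_χ(M)`. [cite: Curticapean2021, §1] -/
theorem IsClassFunction.genMatrixFun_transpose {R : Type u} [CommSemiring R]
    {χ : Equiv.Perm n → R} (hχ : IsClassFunction χ) (M : Matrix n n R) :
    genMatrixFun χ M.transpose = genMatrixFun χ M := by
  rw [Literature.Computability.AlgebraicComplexity.genMatrixFun_transpose]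
  simp only [hχ.map_inv]

end ClassFunction

/-! ### The long-cycle locus `Π_k(n)` -/

section LongCycles

variable (n : Type*) [Fintype n] [DecidableEq n]

/-- The *long-cycle locus* `Π_k(n) ⊆ 𝔖ₙ` of route `ImmanantSlice`: the permutations without fixed
points all of whose cycles have length `> k`. (`Equiv.Perm.cycleType` lists the lengths of the
cycles of length `≥ 2`, so fixed-point-freeness is a separate condition.) [folklore] -/
def longCycleLocus (k : ℕ) : Finset (Equiv.Perm n) :=
  univ.filter fun σ => (∀ i, σ i ≠ i) ∧ ∀ m ∈ σ.cycleType, k < m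

variable {n}

/-- Membership in `Π_k(n)`, literally the pair of hypotheses inlined in route `ImmanantSlice`.
[folklore] -/
@[simp]
theorem mem_longCycleLocus {k : ℕ} {σ : Equiv.Perm n} :
    σ ∈ longCycleLocus n k ↔ (∀ i, σ i ≠ i) ∧ ∀ m ∈ σ.cycleType, k < m := by
  simp [longCycleLocus]

/-- A permutation of a finite type has no fixed point iff its cycle lengths sum to `card n`
(`Equiv.Perm.sum_cycleType`: they sum to the size of the support); in particular
fixed-point-freeness depends only on the cycle type. [folklore] -/
theorem fixedPointFree_iff_sum_cycleType {σ : Equiv.Perm n} :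
    (∀ i, σ i ≠ i) ↔ σ.cycleType.sum = Fintype.card n := by
  rw [Equiv.Perm.sum_cycleType, Finset.card_eq_iff_eq_univ, Finset.eq_univ_iff_forall]
  simp only [Equiv.Perm.mem_support, ne_eq]

/-- Fixed-point-freeness is invariant under conjugation. [folklore] -/
theorem fixedPointFree_congr_isConj {σ τ : Equiv.Perm n} (h : IsConj σ τ) :
    (∀ i, σ i ≠ i) ↔ ∀ i, τ i ≠ i := by
  rw [fixedPointFree_iff_sum_cycleType, fixedPointFree_iff_sum_cycleType,
    Equiv.Perm.isConj_iff_cycleType_eq.mp h]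

/-- Membership in `Π_k(n)` depends only on the cycle type: `σ ∈ Π_k(n)` iff the cycle lengths of
`σ` sum to `card n` (no fixed points, `Equiv.Perm.sum_cycleType`) and all exceed `k`. [folklore] -/
theorem mem_longCycleLocus_iff_cycleType {k : ℕ} {σ : Equiv.Perm n} :
    σ ∈ longCycleLocus n k ↔ σ.cycleType.sum = Fintype.card n ∧ ∀ m ∈ σ.cycleType, k < m := by
  rw [mem_longCycleLocus, fixedPointFree_iff_sum_cycleType]

/-- `Π_k(n)` is a union of conjugacy classes. [folklore] -/
theorem mem_longCycleLocus_congr_isConj {k : ℕ} {σ τ : Equiv.Perm n} (h : IsConj σ τ) :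
    σ ∈ longCycleLocus n k ↔ τ ∈ longCycleLocus n k := by
  rw [mem_longCycleLocus_iff_cycleType, mem_longCycleLocus_iff_cycleType,
    Equiv.Perm.isConj_iff_cycleType_eq.mp h]

/-- `Π_k(n)` shrinks as `k` grows. [folklore] -/
theorem longCycleLocus_anti {k l : ℕ} (hkl : k ≤ l) : longCycleLocus n l ⊆ longCycleLocus n k :=
  fun _ h => mem_longCycleLocus.2
    ⟨(mem_longCycleLocus.1 h).1, fun m hm => lt_of_le_of_lt hkl ((mem_longCycleLocus.1 h).2 m hm)⟩

/-- The identity is never in `Π_k(n)` (for nonempty `n`). [folklore] -/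
theorem one_not_mem_longCycleLocus [Nonempty n] {k : ℕ} : (1 : Equiv.Perm n) ∉ longCycleLocus n k :=
  fun h => (mem_longCycleLocus.1 h).1 (Classical.arbitrary n) rfl

/-- The `n`-cycles (cycle type `{card n}`) lie in `Π_k(n)` as soon as `k < card n`. [folklore] -/
theorem mem_longCycleLocus_of_cycleType_eq_singleton {k : ℕ} {σ : Equiv.Perm n}
    (h : σ.cycleType = {Fintype.card n}) (hk : k < Fintype.card n) : σ ∈ longCycleLocus n k := by
  rw [mem_longCycleLocus_iff_cycleType, h]
  simpa using hk

/-- A product of two disjoint long cycles covering `n` (cycle type `{a, b}`, `a + b = card n`,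
`k < a`, `k < b`) lies in `Π_k(n)`. [folklore] -/
theorem mem_longCycleLocus_of_cycleType_eq_pair {k a b : ℕ} {σ : Equiv.Perm n}
    (h : σ.cycleType = {a, b}) (hab : a + b = Fintype.card n) (ha : k < a) (hb : k < b) :
    σ ∈ longCycleLocus n k := by
  rw [mem_longCycleLocus_iff_cycleType, h]
  refine ⟨by simpa using hab, fun m hm => ?_⟩
  simp only [Multiset.insert_eq_cons, Multiset.mem_cons, Multiset.mem_singleton] at hm
  rcases hm with rfl | rfl
  exacts [ha, hb]

end LongCycles

/-! ### Block substitutions: restriction and cycle insertion are projections -/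

section Blocks

variable {n o : Type*} [Fintype n] [DecidableEq n] [Fintype o] [DecidableEq o]
variable {A : Type*} [CommSemiring A]

omit [Fintype o] in
/-- Entries of the permutation matrix `P_γ := (γ⁻¹).permMatrix` in the column convention of this
file: column `j` has its `1` in row `γ j`. [folklore] -/
theorem permMatrix_inv_apply (γ : Equiv.Perm o) (i j : o) :
    ((γ⁻¹).permMatrix A) i j = if i = γ j then (1 : A) else 0 := by
  simp only [Equiv.Perm.permMatrix, PEquiv.toMatrix_apply, Equiv.toPEquiv_apply,
    Option.mem_def, Option.some.injEq, Equiv.Perm.inv_eq_iff_eq]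

/-- `d_{χ'}(P_γ) = χ' γ`: the only generalized diagonal of `P_γ` is `γ`. [folklore] -/
theorem genMatrixFun_permMatrix (χ : Equiv.Perm o → A) (γ : Equiv.Perm o) :
    genMatrixFun χ ((γ⁻¹).permMatrix A) = χ γ := by
  unfold genMatrixFun
  rw [Finset.sum_eq_single γ]
  · simp
  · intro σ _ hσ
    obtain ⟨b, hb⟩ : ∃ b, σ b ≠ γ b := not_forall.mp fun h => hσ (Equiv.ext h)
    rw [Finset.prod_eq_zero (Finset.mem_univ b) (by simp [Equiv.symm_apply_eq, hb]), mul_zero]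
  · exact fun h => absurd (Finset.mem_univ γ) h

/-- **Block lemma** (the combinatorial heart of the restriction / cycle-insertion operators): for
a coefficient function `χ` on `𝔖_{n ⊔ o}`, a matrix `Y` on `n` and a permutation `γ` of `o`,
`d_χ (Y ⊕ P_γ) = d_{χ'}(Y)` with `χ'(τ) = χ(τ ⊕ γ)` — a generalized diagonal of the block matrix
`fromBlocks Y 0 0 P_γ` is nonzero only for permutations `σ = τ ⊕ γ` preserving the blocks
(`Equiv.Perm.mem_sumCongrHom_range_of_perm_mapsTo_inl`, as in `Matrix.det_fromBlocks_zero₂₁`)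
and inducing `γ` on `o`. [folklore] -/
theorem genMatrixFun_fromBlocks_permMatrix (χ : Equiv.Perm (n ⊕ o) → A) (Y : Matrix n n A)
    (γ : Equiv.Perm o) :
    genMatrixFun χ (Matrix.fromBlocks Y 0 0 ((γ⁻¹).permMatrix A)) =
      genMatrixFun (fun τ => χ (τ.sumCongr γ)) Y := by
  classical
  unfold genMatrixFun
  have hterm : ∀ τ : Equiv.Perm n,
      ∏ i, Matrix.fromBlocks Y 0 0 ((γ⁻¹).permMatrix A) ((τ.sumCongr γ) i) i = ∏ i, Y (τ i) i := by
    intro τ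
    rw [Fintype.prod_sum_type]
    simp
  have hinj : Function.Injective fun τ : Equiv.Perm n => τ.sumCongr γ := by
    intro τ₁ τ₂ h
    ext a
    simpa using Equiv.congr_fun h (Sum.inl a)
  symm
  calc ∑ τ : Equiv.Perm n, χ (τ.sumCongr γ) * ∏ i, Y (τ i) i
      = ∑ τ : Equiv.Perm n, (fun σ : Equiv.Perm (n ⊕ o) =>
          χ σ * ∏ i, Matrix.fromBlocks Y 0 0 ((γ⁻¹).permMatrix A) (σ i) i) (τ.sumCongr γ) := by
        simp only [hterm]
    _ = ∑ σ ∈ univ.map ⟨_, hinj⟩,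
          χ σ * ∏ i, Matrix.fromBlocks Y 0 0 ((γ⁻¹).permMatrix A) (σ i) i := by
        rw [Finset.sum_map]
        rfl
    _ = ∑ σ : Equiv.Perm (n ⊕ o),
          χ σ * ∏ i, Matrix.fromBlocks Y 0 0 ((γ⁻¹).permMatrix A) (σ i) i := by
        refine Finset.sum_subset (subset_univ _) fun σ _ hσ => ?_
        refine mul_eq_zero_of_right _ ?_
        by_cases hmaps : ∀ a : n, ∃ a' : n, σ (Sum.inl a) = Sum.inl a'
        · -- `σ` preserves the blocks: `σ = τ ⊕ γ'`
          have hmaps' : Set.MapsTo σ (Set.range Sum.inl) (Set.range Sum.inl) := by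
            rintro _ ⟨a, rfl⟩
            obtain ⟨a', ha'⟩ := hmaps a
            exact ⟨a', ha'.symm⟩
          obtain ⟨⟨τ, γ'⟩, hτ⟩ := MonoidHom.mem_range.1
            (Equiv.Perm.mem_sumCongrHom_range_of_perm_mapsTo_inl hmaps')
          rw [Equiv.Perm.sumCongrHom_apply] at hτ
          dsimp only at hτ
          have hγ : γ' ≠ γ := by
            rintro rfl
            exact hσ (Finset.mem_map.2 ⟨τ, Finset.mem_univ _, hτ⟩)
          obtain ⟨b, hb⟩ : ∃ b, γ' b ≠ γ b := not_forall.mp fun h => hγ (Equiv.ext h)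
          refine Finset.prod_eq_zero (Finset.mem_univ (Sum.inr b)) ?_
          rw [← hτ]
          simp [Equiv.symm_apply_eq, hb]
        · -- `σ` moves some `inl a` into the `o`-block: the entry is in the zero block
          obtain ⟨a, ha⟩ := not_forall.mp hmaps
          refine Finset.prod_eq_zero (Finset.mem_univ (Sum.inl a)) ?_
          rcases hx : σ (Sum.inl a) with a' | b
          · exact absurd ⟨a', hx⟩ ha
          · simp

/-- Polynomial form of the block lemma: substituting the block matrix `Y ⊕ P_γ` (any matrix `Y`
over an `R`-algebra on the `n`-block, the permutation matrix of `γ` on the `o`-block, zero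
off-diagonal blocks) into `genMatrixPoly χ` is the same as substituting `Y` into
`genMatrixPoly (τ ↦ χ (τ ⊕ γ))`. [folklore] -/
theorem aeval_fromBlocks_genMatrixPoly {R : Type u} [CommSemiring R] [Algebra R A]
    (χ : Equiv.Perm (n ⊕ o) → R) (γ : Equiv.Perm o) (Y : Matrix n n A) :
    aeval (fun ij : (n ⊕ o) × (n ⊕ o) =>
        Matrix.fromBlocks Y 0 0 ((γ⁻¹).permMatrix A) ij.1 ij.2) (genMatrixPoly χ) =
      aeval (fun ij : n × n => Y ij.1 ij.2)
        (genMatrixPoly fun τ : Equiv.Perm n => χ (τ.sumCongr γ)) := by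
  rw [aeval_genMatrixPoly_matrix, aeval_genMatrixPoly_matrix]
  exact genMatrixFun_fromBlocks_permMatrix (fun σ => algebraMap R A (χ σ)) Y γ

variable {R : Type u} [CommSemiring R]

/-- The substitution `X ↦ X ⊕ P_γ` realising `χ ↦ (τ ↦ χ (τ ⊕ γ))` on generic immanants: every
variable `X_{(i,j)}` of `genMatrixPoly χ` (indices in `n ⊕ o`) is sent to a variable (block
`n × n`) or to a constant `0`/`1`. [folklore] -/
def permBlockSubst (n : Type*) [Fintype n] [DecidableEq n] (R : Type u) [CommSemiring R]
    (γ : Equiv.Perm o) (ij : (n ⊕ o) × (n ⊕ o)) : MvPolynomial (n × n) R :=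
  Matrix.fromBlocks (Matrix.mvPolynomialX n n R) 0 0 ((γ⁻¹).permMatrix _) ij.1 ij.2

omit [Fintype o] in
/-- Unfolding lemma for `permBlockSubst`. [folklore] -/
theorem permBlockSubst_apply (γ : Equiv.Perm o) (ij : (n ⊕ o) × (n ⊕ o)) :
    permBlockSubst n R γ ij =
      Matrix.fromBlocks (Matrix.mvPolynomialX n n R) 0 0 ((γ⁻¹).permMatrix _) ij.1 ij.2 :=
  rfl

omit [Fintype o] in
/-- Each value of `permBlockSubst` is a variable or a constant (so `aeval (permBlockSubst n R γ)`
is a Valiant projection). [folklore] -/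
theorem permBlockSubst_isVar_or_isConst (γ : Equiv.Perm o) (ij : (n ⊕ o) × (n ⊕ o)) :
    (∃ j, permBlockSubst n R γ ij = X j) ∨ ∃ c, permBlockSubst n R γ ij = C c := by
  obtain ⟨i | b, j | b'⟩ := ij
  · exact Or.inl ⟨(i, j), rfl⟩
  · exact Or.inr ⟨0, by simp [permBlockSubst]⟩
  · exact Or.inr ⟨0, by simp [permBlockSubst]⟩
  · refine Or.inr ⟨if b = γ b' then 1 else 0, ?_⟩
    simp [permBlockSubst, apply_ite C, Equiv.symm_apply_eq]

/-- **Cycle insertion / restriction as a substitution.** For `χ : 𝔖_{n ⊔ o} → R` and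
`γ ∈ 𝔖_o`: `genMatrixPoly (τ ↦ χ (τ ⊕ γ)) = (genMatrixPoly χ)(X ⊕ P_γ)`. With `γ` a `j`-cycle
this is the insertion of a `j`-cycle block, with `γ = 1` the restriction to permutations with
`|o|` extra fixed points (`genMatrixPoly_sumCongr_one`). [folklore] -/
theorem genMatrixPoly_sumCongr (χ : Equiv.Perm (n ⊕ o) → R) (γ : Equiv.Perm o) :
    genMatrixPoly (fun τ : Equiv.Perm n => χ (τ.sumCongr γ)) =
      aeval (permBlockSubst n R γ) (genMatrixPoly χ) := by
  have hX : (fun ij : n × n => Matrix.mvPolynomialX n n R ij.1 ij.2) = X := by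
    funext ij
    rfl
  rw [show permBlockSubst n R γ = fun ij : (n ⊕ o) × (n ⊕ o) =>
      Matrix.fromBlocks (Matrix.mvPolynomialX n n R) 0 0 ((γ⁻¹).permMatrix _) ij.1 ij.2 from rfl,
    aeval_fromBlocks_genMatrixPoly, hX, aeval_X_left_apply]

/-- Restriction `𝔖_{n ⊔ o} → 𝔖ₙ` (extend `τ` by fixed points on `o`) is the substitution of the
block matrix `X ⊕ 1`: `genMatrixPoly (τ ↦ χ (τ ⊕ 1)) = (genMatrixPoly χ)(X ⊕ 1)`. [folklore] -/
theorem genMatrixPoly_sumCongr_one (χ : Equiv.Perm (n ⊕ o) → R) :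
    genMatrixPoly (fun τ : Equiv.Perm n => χ (τ.sumCongr 1)) =
      aeval (fun ij : (n ⊕ o) × (n ⊕ o) =>
        Matrix.fromBlocks (Matrix.mvPolynomialX n n R) 0 0 (1 : Matrix o o _) ij.1 ij.2)
        (genMatrixPoly χ) := by
  rw [genMatrixPoly_sumCongr χ 1]
  have h : permBlockSubst n R (1 : Equiv.Perm o) = fun ij : (n ⊕ o) × (n ⊕ o) =>
      Matrix.fromBlocks (Matrix.mvPolynomialX n n R) 0 0 (1 : Matrix o o _) ij.1 ij.2 := by
    funext ij
    rw [permBlockSubst_apply, inv_one, Matrix.permMatrix_one]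
  rw [h]

/-- Renaming variables is a projection (substitute the variable `X (φ i)` for `X i`).
[cite: Burgisser2000, Def. 2.6(1)] -/
theorem isProjection_rename_self {σ τ : Type*} (φ : σ → τ) (f : MvPolynomial σ R) :
    IsProjection (rename φ f) f :=
  have h : (rename φ : MvPolynomial σ R →ₐ[R] MvPolynomial τ R) = aeval fun i => X (φ i) :=
    MvPolynomial.algHom_ext fun i => by simp
  ⟨fun i => X (φ i), fun i => Or.inl ⟨φ i, rfl⟩, DFunLike.congr_fun h f⟩

/-- **The cheap operators are Valiant projections** (Bürgisser 2000, Def. 2.6(1)): for every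
`χ : 𝔖_{n ⊔ o} → R` and `γ ∈ 𝔖_o`, the generic immanant of `τ ↦ χ (τ ⊕ γ)` on `n` is a projection
of the generic immanant of `χ` (substitute `X ⊕ P_γ`). [cite: Burgisser2000, Def. 2.6(1)] -/
theorem isProjection_genMatrixPoly_sumCongr (χ : Equiv.Perm (n ⊕ o) → R) (γ : Equiv.Perm o) :
    IsProjection (genMatrixPoly fun τ : Equiv.Perm n => χ (τ.sumCongr γ)) (genMatrixPoly χ) :=
  ⟨permBlockSubst n R γ, permBlockSubst_isVar_or_isConst γ, genMatrixPoly_sumCongr χ γ⟩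

end Blocks

/-! #### Relabeling the index type; `Fin`-indexed forms -/

section Relabel

variable {n m : Type*} [Fintype n] [DecidableEq n] [Fintype m] [DecidableEq m]
variable {R : Type u} [CommSemiring R]

/-- Relabeling the index type along `e : n ≃ m`: the generic immanant of `χ ∘ e.permCongr` on `n`
is the generic immanant of `χ` on `m` with its variables renamed along `e.symm × e.symm`.
[folklore] -/
theorem genMatrixPoly_comp_permCongr (e : n ≃ m) (χ : Equiv.Perm m → R) :
    genMatrixPoly (fun σ : Equiv.Perm n => χ (e.permCongr σ)) =
      rename (Prod.map e.symm e.symm) (genMatrixPoly χ) := by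
  unfold genMatrixPoly
  rw [map_sum, ← Equiv.sum_comp e.permCongr]
  refine Finset.sum_congr rfl fun σ _ => ?_
  rw [map_mul, rename_C, map_prod]
  congr 1
  refine Fintype.prod_equiv e _ _ fun j => ?_
  simp [Equiv.permCongr_apply]

/-- Relabeling is a projection in both directions; in particular
`genMatrixPoly (χ ∘ e.permCongr)` is a projection of `genMatrixPoly χ`.
[cite: Burgisser2000, Def. 2.6(1)] -/
theorem isProjection_genMatrixPoly_comp_permCongr (e : n ≃ m) (χ : Equiv.Perm m → R) :
    IsProjection (genMatrixPoly fun σ : Equiv.Perm n => χ (e.permCongr σ)) (genMatrixPoly χ) := by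
  rw [genMatrixPoly_comp_permCongr]
  exact isProjection_rename_self _ _

/-- **`Fin`-indexed cycle insertion / restriction is a projection**: for
`χ : 𝔖_{m+j} → R` (on `Fin (m + j)`) and `γ ∈ 𝔖_j`, the generic immanant on `Fin m` of
`τ ↦ χ (τ ⊕ γ)` — `τ` acting on the first `m` letters, `γ` on the last `j`, glued by
`finSumFinEquiv` — is a projection of `genMatrixPoly χ`; `γ = 1` is the restriction
`𝔖_{m+j} → 𝔖_m`, `γ` a `j`-cycle (e.g. `finRotate j`) the insertion of a `j`-cycle.
[cite: Burgisser2000, Def. 2.6(1)] -/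
theorem isProjection_genMatrixPoly_finSum (m j : ℕ) (χ : Equiv.Perm (Fin (m + j)) → R)
    (γ : Equiv.Perm (Fin j)) :
    IsProjection
      (genMatrixPoly fun τ : Equiv.Perm (Fin m) => χ (finSumFinEquiv.permCongr (τ.sumCongr γ)))
      (genMatrixPoly χ) :=
  IsProjection.trans_holds
    (isProjection_genMatrixPoly_sumCongr (fun σ => χ (finSumFinEquiv.permCongr σ)) γ)
    (isProjection_genMatrixPoly_comp_permCongr finSumFinEquiv χ)

end Relabel

end Literature.Computability.AlgebraicComplexity
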